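import Mathlib
import Mathlib.NumberTheory.LSeries.ZetaZeros
import Mathlib.NumberTheory.ArithmeticFunction.VonMangoldt
import Mathlib.Analysis.SpecialFunctions.Gamma.Digamma
import Mathlib.Analysis.SpecialFunctions.Trigonometric.Deriv
import Mathlib.Analysis.Convolution
import Mathlib.Analysis.Calculus.ContDiff.Convolution
import Mathlib.Analysis.Calculus.ContDiff.Operations
import Mathlib.NumberTheory.Harmonic.ZetaAsymp
import Literature.NumberTheory.LFunctions.ZetaZeros
import HarnessLib.Audit
import Literature.NumberTheory.LFunctions.WeilExplicit
import HarnessLib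

/-!
# WeilPositivity — CONJECTURE (obligation of RiemannHypothesis/RiemannHypothesis)

Unproven conjecture migrated by the gate from `Literature/NumberTheory/LFunctions/WeilExplicit.lean` (`Literature.NumberTheory.LFunctions.WeilPositivity`): unproven conjectures are obligations of our
theories, not literature facts (human ruling 2026-08-15). Provenance: Weil1952FormulesExplicites. Routes use it as a crux item or via
`--conditional-bridge --conditional-on WeilPositivity`; a proof goes in the sibling `Theorems/WeilPositivityHolds.lean` as `theorem WeilPositivity_holds : WeilPositivity` so this file stays a conjecture LEAF that Literature/ may import.
-/

namespace Summit.RiemannHypothesis.RiemannHypothesis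

open Literature Literature.NumberTheory Literature.NumberTheory.LFunctions
open Complex Filter Set MeasureTheory
open scoped Real Topology Convolution ContDiff ArithmeticFunction.vonMangoldt ComplexConjugate

/-- OPEN CONJECTURE — Weil positivity for `ζ` [status: open]: `Re W(g ⋆ g̃) ≥ 0` for every
smooth compactly supported `g : ℝ → ℂ` (Weil's quadratic functional `weilQuadratic` is positive
semidefinite on `IsWeilTest`). POSED by A. Weil (1952), who "formulated the Riemann Hypothesis as
the positivity of a certain quadratic functional arising from the Explicit Formula" (Bombieri 2000,
§1 p. 184, bib `Bombieri2000Weil`); in the present `ζ`-only, additive, `1/2`-symmetric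
normalisation it is "`T[f * f̄*] ≥ 0` on `C₀^∞((0, ∞))`" of Bombieri 2000, Theorem 2 (p. 193), and
by that theorem (Weil's criterion) it is EQUIVALENT TO THE RIEMANN HYPOTHESIS — in the tree
unconditionally: `weil_criterion_holds : RiemannHypothesis ↔ WeilPositivity`
(`WeilCriterionProofs.lean`; axioms `propext`, `Classical.choice`, `Quot.sound`). Hence a term
`WeilPositivity_holds` would prove Mathlib's `RiemannHypothesis`: this is a registered OPEN
statement (CONVENTIONS §4), not literature debt; users take `(h : WeilPositivity)`. Known
direction: `WeilPositivity.of_riemannHypothesis` (`WeilExplicitProofs.lean`). Name kept without a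
`…Conjecture` suffix because it has users (`weil_criterion`, `WeilCriterion.lean`,
`UniformWeilPositivityRH.lean`, route theses `…/RiemannHypothesis/Theses/WeilPos.lean`, `SpectralTrace.lean`).
[cite: Weil1952FormulesExplicites, pp. 252–265 (RH formulated as positivity of the explicit-formula functional); ζ-form Bombieri2000Weil Thm. 2 p. 193] -/
@[conjecture] def WeilPositivity : Prop :=
  ∀ g : ℝ → ℂ, IsWeilTest g → 0 ≤ (weilQuadratic g).re

end Summit.RiemannHypothesis.RiemannHypothesis
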